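import Summits.BirchSwinnertonDyer.BirchSwinnertonDyer.Theses.ManinLocalTwoThree
import Literature.NumberTheory.EllipticCurves.ManinConstantNonPotentiallyOrdinaryPrimes
import Literature.NumberTheory.EllipticCurves.ManinConstantClassCertificateTwistGamma0Proofs
import Literature.NumberTheory.EllipticCurves.GaloisAction
import HarnessLib

/-!
# Crux `ManinLocalTwoThree.ManinPrimeToAdditiveFiveLe` (stmt-BirchSwinnertonDyer-22969) — line «ordinary-gauge»
# (ideator bsd-idea-8 g3, lens nearmiss; W-71 crux-level skeleton, published only (W-79); BSD is not proved by any of this)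

THE NEAR-MISS.  Edixhoven 1991, Thm. 3 (tree fact `edixhoven_not_dvd_maninConstant_of_not_potentiallyGoodOrdinary`,
statement only; typescript L115–118 and L705–710): for the strong curve `E` of level `N`, `p > 7`, `p ∤ c` EXCEPT when
`E` has potentially ORDINARY reduction at `p` of Kodaira type II, III or IV — there the special fibre of the stable
model of `X₀(p²M)` carries components on which Frobenius and Verschiebung of `E[p]` "commute" and the argument only
yields `v_p(c) ≤ 1` ("we cannot prove that case 1 does not occur").  MEASURED DEFICIT: one factor `p`, exactly on the
principal-series (= potentially ordinary, see CELLS) locus.  SINGLE INPUT TO IMPROVE: decide the missing factor on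
that locus.  This line replaces special-fibre geometry there by GALOIS LATTICES.

THE LEVER (ordinary gauge).  Notation: `f` the newform, `𝔪 ∋ p` its maximal Hecke ideal, `J = J₀(N)`,
`E' ⊂ J` the optimal sub-abelian variety (`≅ E`), `A = ker(J → E)`, `ῑ : E'[p^k] ↪ A[p^k]` the congruence gluing
(`E' ∩ A`, Hecke-equivariant, so it lands in `A_𝔪`), `K'/ℚ_p^{nr}` a TAME Galois extension over which `J` is
semistable (exists for `p ≥ 5`: every constituent has conductor exponent `≤ 2`), `Γ = Gal`, `R' = 𝓞_{K'}`,
`T^f ⊂ T_p J` Grothendieck's finite (fixed) part over `R'`, `(·)⁰` = the saturated sub-lattice on which `G_{K'}`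
acts through `ε ⊗ (unramified)` (Hodge–Tate weight one part; for an ordinary-type constituent = its ordinary line).
  (G1) [Česnavičius–Neururer–Saha, tree fact `cesnaviciusNeururerSaha_thm_1_2` circle]  `ω_f ∈ H⁰(𝒥, Ω¹)` and is
       PRIMITIVE there (`a₁ = 1`), whence for the LATTICE-OPTIMAL `D`:  `v_p(c(D)) = length coker(Lie 𝒥 → Lie ℰ)_p`.
  (G2) [Edixhoven 1992 tame descent, `𝒜 = (Res 𝒜_{R'})^Γ`; Grothendieck SGA 7 IX finite part; Tate 1967 full
       faithfulness]  `Lie 𝒥⁰_{R'} = Lie 𝒢(T^f)`, `Lie ℰ⁰_{R'} = Lie 𝒢(T_pE)`, the map being induced by `T^f → T_pE`,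
       and `Lie` over `ℤ_p^{nr}` is recovered as `Γ`-invariants (exact: `Γ` has order prime to `p`).
  (G3) [connected–étale sequence; a `p`-divisible group with unramified Tate module over a strictly henselian base is
       étale]  if `𝒢(L)` is ORDINARY (every constituent of `L ⊗ ℚ` ordinary-type) then `𝒢(L)⁰` is of multiplicative
       type with Tate module `L⁰` and `Lie 𝒢(L) = L⁰(−1) ⊗ R'`, functorially and exactly in `L`.
  ⟹  ORDINARY GAUGE IDENTITY: if every `𝔪`-congruent constituent of `J` is ordinary-type at `p` (ORD-𝔪), then
          `v_p(c(D)) = δ := length_{ℤ_p} coker( (T^f_𝔪 J)⁰ → (T_pE)⁰ )`,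
       and in general `v_p(c(D)) ≤ δ` (non-ordinary connected directions can only enlarge the image).
  (G4) CRITERION.  `δ = 0 ⟺ ῑ(C_k) ⊂ A_𝔪[p^k]^{f,0}` for all `k`, where `C_k ⊂ E'[p^k]` is the canonical (multiplicative-
       type) cyclic subgroup; SUFFICIENT: `Hom_{G_{ℚ_p}}(C_k, A_𝔪[p^k] / A_𝔪[p^k]^{f,0}) = 0`.
  (G5) DISTINGUISHEDNESS + LOCAL ORDINARITY FORCING (all print).  `E[p]|_{G_{ℚ_p}} = (ψ̄ * ; 0 ψ̄')`, `ψ̄|_I = χ̄ω = ω^{a+1}`,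
       `ψ̄'|_I = χ̄⁻¹ = ω^{−a}`, `χ̄|_I` of exact order `e ∈ {3,4,6}`, `e ∣ p−1`; always `ψ̄|_I ≠ ψ̄'|_I`, and for `e ≠ p−1` both are
       ramified.  NON-SPLIT ⟺ wild inertia acts non-trivially ⟹ `ψ̄` is the unique stable line.  Congruent constituents `g` of `A_𝔪`:
       (a) `p`-old or Steinberg-at-`p`: inertial Jordan–Hölder set `{ω, 1} ≠ {ω^{a+1}, ω^{−a}}` — impossible since
       `a ≢ 0, −1 (mod p−1)` for `3 ≤ e`, `e ≠ p−1`; (b) principal series of type `χ' ⊕ χ'⁻¹`: by SAVITT 2005 (necessity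
       direction of CDT Conj. 1.2.3; quoted as
       Gee, Math. Ann. 2011, Thm. 4.6.1 [corpus:paper-arxiv-0810.1877 p17 L86–108]) a potentially Barsotti–Tate lift of type
       `ω̃^i ⊕ ω̃^j` exists ONLY IF `ρ̄|_{I_p} ≅ (ω^{1+i} * ; 0 ω^j)` or `(ω^{1+j} * ; 0 ω^i)` AS EXTENSIONS — for non-split `ρ̄` this forces
       `χ̄' = χ̄^{±1}` (ALIGNED; the flipped types `χ̄' = (χ̄ω)^{∓1}` need the sub and quotient swapped, available only when `ρ̄` is
       SPLIT = the companion locus, residual R3); (c) an aligned `g` becomes crystalline over the abelian `K' = K_{χ'}` with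
       `e(K') = e < p − 1` and `ρ̄_g^{ss}|_{I_{K'}} = ω ⊕ 1`, so by Raynaud (`e' < p−1`: unique prolongations, `ω ↦ μ`-type, `1 ↦` étale)
       the connected part of `𝒢_g[p]` has order `p`, whence `𝒢_g` is ORDINARY with ordinary line reducing to `ψ̄`.  Hence (ORD-𝔪) holds,
       every graded piece of `A_𝔪[p^k]/A_𝔪[p^k]^{f,0}` is filtered by `ψ̄' ≢ ψ̄ = C̄_1` on inertia, (G4) vanishes, `δ = 0`, `p ∤ c`.
       Equivalent bookkeeping (snake lemma on the ordinary filtrations of `T_𝔪J ↠ T_pE`): `δ =` the saturation defect of `T_𝔪A` in the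
       étale quotient `T_𝔪J/(T_𝔪J)⁰`; it vanishes as soon as that quotient is free of rank one over `T_𝔪` (`T_𝔪A^{et} = I_f` is then
       saturated) — a second, Hecke-side route to `δ = 0` (Gorenstein / multiplicity one at `𝔪`, transported from Hida theory at level
       `Γ₁(pM)` by the order-`e` twist), recorded for the prover, not used by the stubs.
  CONSEQUENCE CLAIMED BY THE HARD STUB G (`stub_nonsplitPrincipalSeriesGauge`): lattice-optimal `D`, `p ≥ 5`, `p² ∣ N`,
  potentially good with `e ∣ p − 1`, `e ≠ p − 1`, `E[p]` irreducible and `E[p]|_{G_{ℚ_p}}` NON-SPLIT ⟹ `p ∤ c(D)`.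
  This is `≈ (1 − 1/p)` of every potentially-ordinary II/III/IV/IV*/III*/II* class at `p ≥ 11` and the cells
  `(7; IV, IV*)` — all OUTSIDE print (Edixhoven gives `v_p(c) ≤ 1` there; Mazur/Abbes–Ullmo/ČNS need `p² ∤ N`).
  SANITY WITNESS (inside the known regime, not a rung): for `p ∥ N` the same bookkeeping re-derives Mazur's `p ∤ c`
  in the non-split case — (ORD-𝔪) is automatic there because a supersingular `p`-old `g ≡ f` would need
  `0 ≡ a_p(g)² ≡ (p+1)²`, impossible.

CELLS (elementary, exhaustive by excluded middle; `e := 12 / gcd(12, v_p(Δ_min))`, "potentially multiplicative" :=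
`v_p(j) < 0`).  For additive `p ≥ 5`: potentially good with `e ∈ {3,4,6}` forces `j ≡ 0` or `1728 (mod p)`, so
PRINCIPAL SERIES (`e ∣ p − 1`) ⟺ POTENTIALLY ORDINARY and SUPERCUSPIDAL (`e ∤ p − 1`) ⟺ POTENTIALLY SUPERSINGULAR
(Deuring); this is why the cells below are typed by divisibility alone.
  Q  `stub_quadraticTwistCell`      pot. multiplicative or `e = 2`: closable NOW from the tree theorem
                                    `not_dvd_maninConstant_of_isTwistOfSemistableAt_gamma0` (+ the `p*`-twist partner).
  R2 `stub_kummerCornerResidual`    `e = p − 1` (`(5; III, III*)`, `(7; II, II*)`; vacuous for `p ≥ 11` by Ogg's window):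
                                    RESIDUAL = route TeichmullerTwistDescent's KummerCorner items (stmt-23883/24306/24307/24308).
  G  `stub_nonsplitPrincipalSeriesGauge`  `e ∣ p−1`, `e ≠ p−1`, irreducible, non-split: THE NEW THEOREM (hardest).
  R3 `stub_exceptionalPrincipalSeriesResidual`  `e ∣ p−1`, `e ≠ p−1`, (`E[p]` reducible or SPLIT at `p` = companion-form
                                    locus, density `≈ 1/p`): RESIDUAL-OPEN; the gauge reduces it to "`ῑ` maps canonical
                                    subgroups into `A_𝔪[p^k]^{f,0}`", testable numerically class by class.
  F  `stub_edixhovenSupercuspidalCell`  `e ∤ p − 1`, `p > 7`: PRINT PORT of Edixhoven Thm. 3 (its potentially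
                                    supersingular rows; the tree fact is statement-only, so closing F = formalising print).
  R1 `stub_supercuspidalSmallResidual`  `e ∤ p − 1`, `p ≤ 7` (`(5; IV, IV*, II, II*)`, `(7; III, III*)`): RESIDUAL =
                                    TeichmullerTwistDescent.SupercuspidalOptimalManinUnitFiveSeven (stmt-22639) / EF57 K★ (stmt-22226).
COMPOSITION `ManinPrimeToAdditiveFiveLe_of_stubs` / `ManinPrimeToAdditiveFiveLe_of`: pure case logic, sorry-free,
concluding `Summit.BirchSwinnertonDyer.BirchSwinnertonDyer.Theses.ManinLocalTwoThree.ManinPrimeToAdditiveFiveLe` BY NAME.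

WHY NOVEL vs the lines/routes on this crux (levers in five words each): `upper_anchor` (g0, of record) — `p*`-twist
orbit direction law; `tame_twist_mu` (g2) — tame twisted `L`-value unit; `neron_smooth` (bsd-idea-19) — Lie/Dieudonné
witness on `X₀(p²)` fibre; EF57 K★ — Kato `F″` Néron integrality; TeichmullerTwistDescent PSMU/SCMU/OLV — nebentypus
descent to `J₁(pM)` and `p*`-saturation.  Here: NO special fibre of a modular curve, NO `L`-value, NO twist; the object is
the Hecke–Galois lattice `T^f_𝔪 J₀(N)` with its ordinary filtration and the congruence embedding `ῑ`, and the input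
theorems are integral `p`-adic Hodge theory of ORDINARY `p`-divisible groups over a tame base plus local deformation
theory of tame principal-series type (CDT/Savitt).  Presearch (corpus fts+vec AND galaxy): no hit for a Galois-lattice /
ordinary-filtration reading of the Manin constant ("multiplicative subgroup J0(N) Manin constant", vsearch of the gauge
identity, galaxy "Manin constant" pdf 8 hits none relevant, "multiplicative subgroups of J" 0); nearest print: Mazur 1978
§III (q-expansion + étaleness for `p ∥ N`), ČNS 2021 [corpus:paper-arxiv-1911.09446 p2–4] (Lie-algebra index `≤ v_p(deg φ)`),
Vatsal 2005 (multiplicative subgroups of `J₀(N)`, Duke/JIMJ) for the object `(T_𝔪 J)⁰`, the `J₀(431)` Manin-constant-2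
example from multiplicity-one failure [corpus:paper-doi-10-1016-j-jnt-2004-07-008 p3] for "congruence geometry decides `c`".
bears_on: LADDER-BSD row 13 (Manin binder C5, residual conjunct of route ManinLocalTwoThree).
CHEAPEST FALSIFIERS: (1) DESK CHECK, 1 h, of the two non-print joints: the Raynaud ordinarity lemma in (G5)(c) ("crystalline
`HT(0,1)` over `K'`, `e(K') < p−1`, `ρ̄^{ss}|_{I_{K'}} = ω ⊕ 1` ⟹ ordinary"; Raynaud 1974 §3 / Conrad 1999 low-ramification) and the
identification (G2) `Lie 𝒥⁰_{R'} = Lie 𝒢(T^f)` for the semistable `J_{K'}` (SGA 7 IX §7) — a slip in either costs the line its engine.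
(2) INSTRUMENT ROW (kit 0 here — named, not run): Cremona `allisog/alldegphi/opt_man`: optimal `E` with `p² ∣ N`, `p ∈ {7, 13}`,
`e ∣ p−1`, `3 ≤ e < p−1`, `p ∣ deg φ` (a congruence exists): per class decide `E[p]|_{G_{ℚ_p}}` split/non-split (companion form test)
and whether `ῑ(C_1) ⊂ A[p]^{f,0}` (modular symbols mod `p`); ONE non-split class with `ῑ(C_1) ⊄ A[p]^{f,0}` refutes (G3)–(G5), since
`c = 1` there.  (3) SANITY (inside the known regime): the same bookkeeping at `p ∥ N` must return Mazur's `p ∤ c` — it does, (ORD-𝔪)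
being automatic there (`a_p(g)² ≡ (p+1)²` excludes supersingular `p`-old congruences).
DISPROOF USED: none registered for this crux (`ledger crux ls`: no Disproof.lean); negatives index checked (no Manin entry).
REV 2 (2026-08-28, after critic VERDICT #20 PASS-WITH-PRICE and the seat's desk check `Lines/ordinary-gauge-deskcheck.md`):
(P1) the two joints of stub G are now NAMED SUB-CLAIMS with cite lines, (G-L) and (G-R) in the docstring of
`stub_nonsplitPrincipalSeriesGauge`, written out in the desk check §2–§3 (they are not typable as Lean stubs today: Néron-model Lie
algebras, `p`-divisible groups over `ℤ_p[ζ_e]` and `T_𝔪J₀(N)` are absent from Mathlib and the tree — recorded as the definition gap,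
not hidden); the desk check found NO failing joint and moved (G1) INTO PRINT in the direction G uses (ČNS integrality
`ω_f ∈ H⁰(𝒥₀(N),Ω¹)_{(p)}`, `p ≥ 5`: (wf-integral)+(rat-sing-main) [corpus:paper-arxiv-1911.09446 p3 L73–75, p4 L1–12]; primitivity is
NOT needed); the algebraic heart of (G4) ⟸ (G5) — an equivariant surjection is surjective on the `λ₁`-eigenlattice when the source
endomorphism satisfies a split quadratic relation with unit discriminant — is PROVED below (`exists_eigen_preimage`, `map_eigen_eq`,
no sorry), with the corrected inertia element `σ`, `ε(σ) = ζ̃ ∈ μ_{p−1}`, eigenvalues `ζ̃^{a'+1} ≠ ζ̃^{−a'}`.  (P3) `linter.dupNamespace`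
silenced.  Stub names, statements and the composition are UNCHANGED from rev 1 (sha16 dae4ea1b240d9a77).
HONESTY: a line, not a proof; every stub below is `sorry`; BSD is not proved by any of this.
-/

set_option linter.dupNamespace false

noncomputable section

open scoped MatrixGroups ModularForm Classical

open CongruenceSubgroup Literature.NumberTheory.EllipticCurves
  Literature.NumberTheory.EllipticCurves.ModularForms WeierstrassCurve

namespace Summit.BirchSwinnertonDyer.BirchSwinnertonDyer.Cruxes.ManinPrimeToAdditiveFiveLe.OrdinaryGauge

/-- The tame ramification index `e_p(E) = 12 / gcd(12, v_p(Δ_min))` of a potentially good additive fibre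
(the order of inertia acting on `T_ℓ E`; Serre–Tate, Kraus).  Total in `v`, used only under `p² ∣ N`, `v_p(j) ≥ 0`. -/
def tameIndex (W : WeierstrassCurve ℚ) [W.IsElliptic] [W.IsGloballyMinimal] (p : ℕ) : ℕ :=
  12 / Nat.gcd 12 (padicValInt p W.minimalDiscriminantInt)

/-- `E[p]|_{G_{ℚ_p}}` is SPLIT: the geometric `p`-torsion of `E/ℚ_p` has two distinct proper non-zero
`Γ_{ℚ_p}`-stable subgroups (for the 2-dimensional `𝔽_p`-space `E[p]`: two distinct stable lines).  Its negation on the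
reducible-at-`p` (potentially ordinary) locus is "non-split" — the companion-form dichotomy (Gross 1990). -/
def IsLocallySplitModP (W : WeierstrassCurve ℚ) (p : ℕ) [Fact p.Prime] : Prop :=
  ∃ H₁ H₂ : AddSubgroup ((W.baseChange ℚ_[p]).geomTorsion p),
    H₁ ≠ H₂ ∧ H₁ ≠ ⊥ ∧ H₁ ≠ ⊤ ∧ H₂ ≠ ⊥ ∧ H₂ ≠ ⊤ ∧
      ∀ σ : Field.absoluteGaloisGroup ℚ_[p], (∀ P ∈ H₁, σ • P ∈ H₁) ∧ (∀ P ∈ H₂, σ • P ∈ H₂)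

/-- STUB Q (quadratic-twist cell; M–L, closable now).  Potentially multiplicative (`v_p(j) < 0`, Kodaira `I_n^*`) or
`e = 2` (Kodaira `I₀^*`): `E` is the `p*`-twist of a curve semistable at `p`, and the tree THEOREM
`not_dvd_maninConstant_of_isTwistOfSemistableAt_gamma0` (Mazur + Abbes–Ullmo + Česnavičius + CNS Thm. 1.2 under
quadratic twist, proved in `ManinConstantClassCertificateTwistGamma0Proofs`) gives `p ∤ c` once the twist partner `W'`
(globally minimal model of `E ⊗ χ_{p*}`, conductor `N/p` or `N/p²`) is produced — that production (Tate's algorithm under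
quadratic twist) is the content of the stub.  Why it might fail: only by a slip in the partner's conductor bookkeeping. -/
theorem stub_quadraticTwistCell :
    mazur_not_dvd_maninConstant_of_odd → abbesUllmo_not_dvd_maninConstant_of_not_dvd_level →
    cesnavicius_not_two_dvd_maninConstant_of_two_dvd_level → exists_isNewformOf →
    ∀ (W : WeierstrassCurve ℚ) [W.IsElliptic] [W.IsGloballyMinimal] {N : ℕ} [NeZero N]
      (D : ModularParametrizationData W N),
      (∀ z ∈ D.L.lattice, ∃ w ∈ periodLattice D.f, z = D.c * w) →
      ∀ p : ℕ, [Fact p.Prime] → 5 ≤ p → p ^ 2 ∣ N →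
      (padicValRat p W.j < 0 ∨ tameIndex W p = 2) →
      ¬ (p : ℤ) ∣ D.maninConstant := by
  sorry

/-- STUB R2 (Kummer-corner residual; `e = p − 1`, i.e. `(p, e) ∈ {(5,4), (7,6)}`, vacuous for `p ≥ 11` by Ogg's window
`v_p(Δ_min) ∈ {2,3,4,6,8,9,10}`).  Here `χ̄ω` is unramified, `p`-old / Steinberg congruences and the flat–étale ambiguity
enter, and the gauge's distinguishedness (G5) degenerates.  RESIDUAL, not attacked by this line: it is exactly route
TeichmullerTwistDescent's KummerCorner territory (items stmt-BirchSwinnertonDyer-23883, 24306, 24307, 24308).  Why it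
might fail: it is an open case of Manin's conjecture (true for `N ≤ 5·10⁵`, Cremona). -/
theorem stub_kummerCornerResidual :
    ∀ (W : WeierstrassCurve ℚ) [W.IsElliptic] [W.IsGloballyMinimal] {N : ℕ} [NeZero N]
      (D : ModularParametrizationData W N),
      (∀ z ∈ D.L.lattice, ∃ w ∈ periodLattice D.f, z = D.c * w) →
      ∀ p : ℕ, [Fact p.Prime] → 5 ≤ p → p ^ 2 ∣ N →
      0 ≤ padicValRat p W.j → tameIndex W p = p - 1 →
      ¬ (p : ℤ) ∣ D.maninConstant := by
  sorry

/-- STUB G (HARDEST, the new theorem: non-split principal-series ordinary gauge; XL).  Lattice-optimal `D`, `p ≥ 5`,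
`p² ∣ N`, potentially good (`v_p(j) ≥ 0`) with `e ∣ p − 1`, `e ≠ p − 1` (principal series, automatically potentially
ORDINARY since `j ≡ 0, 1728`), `E[p]` irreducible, `E[p]|_{G_{ℚ_p}}` NON-SPLIT ⟹ `p ∤ c(D)`.  Plan = module docstring
(G1)–(G5): CNS primitivity ⟹ `v_p(c) = length coker(Lie 𝒥 → Lie ℰ)`; tame descent + Grothendieck finite part + Tate ⟹
ordinary gauge identity `v_p(c) ≤ δ = length coker((T^f_𝔪J)⁰ → (T_pE)⁰)` (equality under (ORD-𝔪)); Hecke-equivariance of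
the congruence gluing `ῑ` + uniqueness of the stable line `ψ̄` (non-split, `χ̄ω ≠ χ̄⁻¹`, `χ̄ω` ramified) + local ordinarity
forcing (Savitt 2005 necessity = Gee 2011 Thm. 4.6.1: only ALIGNED principal-series types lift a non-split `ρ̄`; Raynaud
`e < p−1` ⟹ aligned constituents are ordinary with line `≡ ψ̄`) ⟹ `Hom_{G_{ℚ_p}}(C_k, A_𝔪[p^k]/A_𝔪[p^k]^{f,0}) = 0` ⟹ `δ = 0`.
Beyond print: Edixhoven 1991 Thm. 3 gives only `v_p(c) ≤ 1` here; modulo the cite-only Kato reading F″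
(`kato_neron_isIntegral_twistedSymbolSum_of_additive_five_le`) the conclusion is already a tree theorem on this locus (p611587) — the
point of G is an F″-INDEPENDENT mechanism (no Euler system, no Kim–Nakamura receptacle).  Why it might fail: (i) the identification
(G2) `Lie 𝒥⁰_{R'} = Lie 𝒢(T^f)` / exact `Γ`-descent of the rank-one cokernel (a slip costs the equality; the line uses only
`v_p(c) ≤ δ`, which needs the multiplicative part of `𝒢(T^f_𝔪)` to sit inside `𝒥⁰_{R'}` with `Lie = (T^f_𝔪)⁰(−1) ⊗ R'`); (ii) [REV 2: DISCHARGED in the direction used —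
the step (G1) needs only INTEGRALITY `ω_f ∈ H⁰(𝒥₀(N), Ω¹)_{(p)}`, which is ČNS (wf-integral)+(rat-sing-main) for `p ≥ 5`; then
`v_p(c) = ι − b ≤ ι := length coker(Lie 𝒥 → Lie ℰ)_p` with `b ≥ 0` the `p`-divisibility of `ω_f` in `Cot(𝒥)_p`; desk check §1]; (iii) a congruent constituent of a type not listed in (G5)(a)–(c) (none exists at conductor exponent `≤ 2`, `p ≥ 5`).
The degenerate sub-cases `e = 1` (impossible under `p² ∣ N`) and `e = 2` (= stub Q) are included for a total case split and are not
the content.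
NAMED JOINTS (rev 2, critic P1 — each separately attackable; full text with page cites in `Lines/ordinary-gauge-deskcheck.md`):
(G-L) LIE JOINT. `K' = K_χ` (totally ramified tame, degree `e < p−1`, `Γ = Gal(K'/ℚ_p)`), primes = Néron models over `R' = 𝒪_{K'}`:
  (a) `Lie 𝒜 = (Lie 𝒜')^Γ` functorially and `(−)^Γ` exact (Edixhoven 1992; [corpus:paper-arxiv-1209.5556 p49 L117–126]);
  (b) Hecke idempotents reduce to the `𝔪`-part; (c) semistable ⇒ `Lie 𝒜' = Lie` of the `p`-divisible group `𝒜'⁰[p^∞]^{conn}`, and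
  `T_p` of the finite part is `T^f` (`= T_p` for the potentially good constituents here); (d) for an ORDINARY `p`-divisible group
  `Lie 𝒢 ⊗ R'^{sh} = T⁰(−1) ⊗ R'^{sh}` functorially ([corpus:book:cornell1997-modular-forms-fermats-last-theorem p409 L33–41]);
  (e) eigenspace length count ⇒ `ι = δ₀ := length_{ℤ_p} coker(T_𝔪J ∩ V⁰ → T_pE ∩ V_E⁰)`.  Only `δ₀ = 0 ⇒ ι = 0` is used.
(G-R) RAYNAUD JOINT. `R` complete dvr, `e(R) < p−1`, `𝒢/R` `p`-divisible of height 2, dimension 1, generic `p`-torsion with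
  semisimplification `ω·u₁ ⊕ u₂` (`uᵢ` unramified) ⇒ `𝒢` ordinary.  Proof (desk check §3): closure of a stable line is finite flat with
  flat quotient (Raynaud 1974 Cor. 3.3.6), rank-`p` pieces are classified by `θ^n`, `0 ≤ n ≤ e`, unique (Thm. 3.3.3/3.4.3
  [corpus:paper-doi-10-24033-bsmf-1779 p29–p31]), `n = e` ⟺ multiplicative, `n = 0` ⟺ étale, distinct as `e < p−1`; a connected–étale
  count gives `|𝒢[p]⁰| = p`, so `𝒢⁰` has height 1 = dimension and is multiplicative (Tate).  Applied PER CONSTITUENT over its own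
  field: aligned `g` is crystalline over `K_χ` with `ρ̄^{ss}| = ω ⊕ 1`, hence ordinary.
(G-S) SAVITT/BOOKKEEPING. Constituents `𝔪`-congruent to `f` at conductor exponent 2, `3 ≤ e < p−1`: only principal series of
  aligned or flipped type (potentially multiplicative ones have inertial characters of order ≤ 2, supercuspidal ones level-2
  characters — neither matches `χ̄^{±1}` of exact order `e`); NON-SPLIT irreducible `ρ̄` admits no flipped type (Gee 2011 Thm. 4.6.1
  [corpus:paper-arxiv-0810.1877 p17 L86–108]).  Then with `σ ∈ I_p`, `ε(σ) = ζ̃`: `T_𝔪J ∩ V⁰` is the `ζ̃^{a'+1}`-eigenlattice and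
  `exists_eigen_preimage` below gives `δ₀ = 0`. -/
theorem stub_nonsplitPrincipalSeriesGauge :
    exists_isNewformOf →
    ∀ (W : WeierstrassCurve ℚ) [W.IsElliptic] [W.IsGloballyMinimal] {N : ℕ} [NeZero N]
      (D : ModularParametrizationData W N),
      (∀ z ∈ D.L.lattice, ∃ w ∈ periodLattice D.f, z = D.c * w) →
      ∀ p : ℕ, [Fact p.Prime] → 5 ≤ p → p ^ 2 ∣ N →
      0 ≤ padicValRat p W.j → tameIndex W p ∣ p - 1 → tameIndex W p ≠ p - 1 →
      W.HasIrreducibleModPGaloisRep p → ¬ IsLocallySplitModP W p →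
      ¬ (p : ℤ) ∣ D.maninConstant := by
  sorry

/-- STUB R3 (exceptional principal-series residual; RESIDUAL-OPEN).  Same cell as G but `E[p]` reducible (Borel; for
`p ≥ 11` and `p² ∣ N` essentially the CM / `p ∈ {11, 17, 37}` isogeny classes) or `E[p]|_{G_{ℚ_p}}` SPLIT (companion-form
locus, density `≈ 1/p` among potentially ordinary classes: Gross 1990 tameness criterion).  Not attacked here; the gauge
reduces the split case to "`ῑ` maps the canonical subgroups `C_k` into `A_𝔪[p^k]^{f,0}`", a class-by-class finite check.
Why it might fail: open case of Manin's conjecture; a split class with `ῑ(C_1) ⊄ A[p]^{f,0}` and (ORD-𝔪) would even give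
`p ∣ c` by the gauge identity — none is known (`c = 1` for `N ≤ 5·10⁵`). -/
theorem stub_exceptionalPrincipalSeriesResidual :
    ∀ (W : WeierstrassCurve ℚ) [W.IsElliptic] [W.IsGloballyMinimal] {N : ℕ} [NeZero N]
      (D : ModularParametrizationData W N),
      (∀ z ∈ D.L.lattice, ∃ w ∈ periodLattice D.f, z = D.c * w) →
      ∀ p : ℕ, [Fact p.Prime] → 5 ≤ p → p ^ 2 ∣ N →
      0 ≤ padicValRat p W.j → tameIndex W p ∣ p - 1 → tameIndex W p ≠ p - 1 →
      (¬ W.HasIrreducibleModPGaloisRep p ∨ IsLocallySplitModP W p) →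
      ¬ (p : ℤ) ∣ D.maninConstant := by
  sorry

/-- STUB F (Edixhoven supercuspidal cell, `p > 7`; L, PRINT PORT).  Potentially good with `e ∤ p − 1`: then `E_F` is still
additive over every subfield `F` of the `p`-th cyclotomic field (ramification index divides `p − 1`), so `E` is NOT
potentially good ordinary in the tree's (G)-shape and Edixhoven 1991 Thm. 3 (`edixhoven_not_dvd_maninConstant_of_not_
potentiallyGoodOrdinary`, statement-only named fact) gives `p ∤ c` for the strong parametrisation; `exists_isNewformOf`
transports the level `N` to the conductor (`IsNewformOf.level_eq_conductorNorm_of_exists_isNewformOf`).  Closing F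
unconditionally = formalising that printed theorem (its potentially supersingular rows are proved for every curve in
Edixhoven's thesis, Thm. 4.6.3; see the fact's module docstring, § PROOF COVERAGE).  Why it might fail: only with print. -/
theorem stub_edixhovenSupercuspidalCell :
    exists_isNewformOf →
    ∀ (W : WeierstrassCurve ℚ) [W.IsElliptic] [W.IsGloballyMinimal] {N : ℕ} [NeZero N]
      (D : ModularParametrizationData W N),
      (∀ z ∈ D.L.lattice, ∃ w ∈ periodLattice D.f, z = D.c * w) →
      ∀ p : ℕ, [Fact p.Prime] → 5 ≤ p → p ^ 2 ∣ N →
      0 ≤ padicValRat p W.j → ¬ tameIndex W p ∣ p - 1 → 7 < p →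
      ¬ (p : ℤ) ∣ D.maninConstant := by
  sorry

/-- STUB R1 (small supercuspidal residual, `p ∈ {5, 7}`, `e ∤ p − 1`: cells `(5; II, IV, IV*, II*)`, `(7; III, III*)`).
RESIDUAL, not attacked by this line (the gauge needs an ordinary filtration): = route TeichmullerTwistDescent's
`SupercuspidalOptimalManinUnitFiveSeven` (stmt-BirchSwinnertonDyer-22639) / EF57 K★ (stmt-BirchSwinnertonDyer-22226) /
Edixhoven's method below `11`.  Why it might fail: open case of Manin's conjecture at the smallest primes. -/
theorem stub_supercuspidalSmallResidual :
    ∀ (W : WeierstrassCurve ℚ) [W.IsElliptic] [W.IsGloballyMinimal] {N : ℕ} [NeZero N]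
      (D : ModularParametrizationData W N),
      (∀ z ∈ D.L.lattice, ∃ w ∈ periodLattice D.f, z = D.c * w) →
      ∀ p : ℕ, [Fact p.Prime] → 5 ≤ p → p ^ 2 ∣ N →
      0 ≤ padicValRat p W.j → ¬ tameIndex W p ∣ p - 1 → p ≤ 7 →
      ¬ (p : ℤ) ∣ D.maninConstant := by
  sorry

/-- ALGEBRAIC CORE of (G4) ⟸ (G5) (rev 2; PROVED, no sorry).  An equivariant surjection `f` whose source endomorphism `σ`
satisfies `(σ − l₁)(σ − l₂) = 0` with `l₁ − l₂` a unit maps the `l₁`-eigenmodule ONTO the `l₁`-eigenmodule of the target.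
Used with `M = T_𝔪J₀(N)`, `N = T_pE`, `f = φ_*`, `σ = τ =` the inertia element with `ε(σ) = ζ̃`, `l₁ = ζ̃^{a'+1}`, `l₂ = ζ̃^{−a'}`,
`u = (l₁ − l₂)⁻¹ ∈ ℤ_p^×`: on the one-type locus the `l₁`-eigenlattice of `T_𝔪J` is `T_𝔪J ∩ V⁰`, so `δ₀ = 0`. -/
theorem exists_eigen_preimage {R M N : Type*} [CommRing R] [AddCommGroup M] [Module R M] [AddCommGroup N] [Module R N]
    (f : M →ₗ[R] N) (σ : M →ₗ[R] M) (τ : N →ₗ[R] N)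
    (hcomm : ∀ x, f (σ x) = τ (f x)) (hf : Function.Surjective f)
    (l₁ l₂ u : R) (hu : u * (l₁ - l₂) = 1)
    (hσ : ∀ x, σ (σ x) = (l₁ + l₂) • σ x - (l₁ * l₂) • x)
    (y : N) (hy : τ y = l₁ • y) :
    ∃ x, σ x = l₁ • x ∧ f x = y := by
  obtain ⟨x, rfl⟩ := hf y
  refine ⟨u • (σ x - l₂ • x), ?_, ?_⟩
  · have h1 := hσ x
    simp only [map_smul, map_sub]
    rw [h1]
    module
  · have h2 : f (σ x) = l₁ • f x := by rw [hcomm]; exact hy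
    simp only [map_smul, map_sub, h2]
    rw [← sub_smul, smul_smul, hu, one_smul]

/-- Submodule form of `exists_eigen_preimage`: `f (ker(σ − l₁)) = ker(τ − l₁)` (rev 2; PROVED, no sorry). -/
theorem map_eigen_eq {R M N : Type*} [CommRing R] [AddCommGroup M] [Module R M] [AddCommGroup N] [Module R N]
    (f : M →ₗ[R] N) (σ : M →ₗ[R] M) (τ : N →ₗ[R] N)
    (hcomm : ∀ x, f (σ x) = τ (f x)) (hf : Function.Surjective f)
    (l₁ l₂ u : R) (hu : u * (l₁ - l₂) = 1)
    (hσ : ∀ x, σ (σ x) = (l₁ + l₂) • σ x - (l₁ * l₂) • x) :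
    Submodule.map f (LinearMap.ker (σ - l₁ • LinearMap.id)) = LinearMap.ker (τ - l₁ • LinearMap.id) := by
  ext y
  simp only [Submodule.mem_map, LinearMap.mem_ker, LinearMap.sub_apply, LinearMap.smul_apply, LinearMap.id_apply,
    sub_eq_zero]
  constructor
  · rintro ⟨x, hx, rfl⟩
    rw [← hcomm, hx, map_smul]
  · intro hy
    obtain ⟨x, hx, hfx⟩ := exists_eigen_preimage f σ τ hcomm hf l₁ l₂ u hu hσ y hy
    exact ⟨x, hx, hfx⟩

/-- COMPOSITION from the stub STATEMENTS (sorry-free; pure case logic on `v_p(j)`, `e = tameIndex W p`, `p`,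
irreducibility and local splitting). -/
theorem ManinPrimeToAdditiveFiveLe_of_stubs
    (hQ : mazur_not_dvd_maninConstant_of_odd → abbesUllmo_not_dvd_maninConstant_of_not_dvd_level →
      cesnavicius_not_two_dvd_maninConstant_of_two_dvd_level → exists_isNewformOf →
      ∀ (W : WeierstrassCurve ℚ) [W.IsElliptic] [W.IsGloballyMinimal] {N : ℕ} [NeZero N]
        (D : ModularParametrizationData W N),
        (∀ z ∈ D.L.lattice, ∃ w ∈ periodLattice D.f, z = D.c * w) →
        ∀ p : ℕ, [Fact p.Prime] → 5 ≤ p → p ^ 2 ∣ N →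
        (padicValRat p W.j < 0 ∨ tameIndex W p = 2) → ¬ (p : ℤ) ∣ D.maninConstant)
    (hR2 : ∀ (W : WeierstrassCurve ℚ) [W.IsElliptic] [W.IsGloballyMinimal] {N : ℕ} [NeZero N]
        (D : ModularParametrizationData W N),
        (∀ z ∈ D.L.lattice, ∃ w ∈ periodLattice D.f, z = D.c * w) →
        ∀ p : ℕ, [Fact p.Prime] → 5 ≤ p → p ^ 2 ∣ N →
        0 ≤ padicValRat p W.j → tameIndex W p = p - 1 → ¬ (p : ℤ) ∣ D.maninConstant)
    (hG : exists_isNewformOf →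
      ∀ (W : WeierstrassCurve ℚ) [W.IsElliptic] [W.IsGloballyMinimal] {N : ℕ} [NeZero N]
        (D : ModularParametrizationData W N),
        (∀ z ∈ D.L.lattice, ∃ w ∈ periodLattice D.f, z = D.c * w) →
        ∀ p : ℕ, [Fact p.Prime] → 5 ≤ p → p ^ 2 ∣ N →
        0 ≤ padicValRat p W.j → tameIndex W p ∣ p - 1 → tameIndex W p ≠ p - 1 →
        W.HasIrreducibleModPGaloisRep p → ¬ IsLocallySplitModP W p → ¬ (p : ℤ) ∣ D.maninConstant)
    (hR3 : ∀ (W : WeierstrassCurve ℚ) [W.IsElliptic] [W.IsGloballyMinimal] {N : ℕ} [NeZero N]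
        (D : ModularParametrizationData W N),
        (∀ z ∈ D.L.lattice, ∃ w ∈ periodLattice D.f, z = D.c * w) →
        ∀ p : ℕ, [Fact p.Prime] → 5 ≤ p → p ^ 2 ∣ N →
        0 ≤ padicValRat p W.j → tameIndex W p ∣ p - 1 → tameIndex W p ≠ p - 1 →
        (¬ W.HasIrreducibleModPGaloisRep p ∨ IsLocallySplitModP W p) → ¬ (p : ℤ) ∣ D.maninConstant)
    (hF : exists_isNewformOf →
      ∀ (W : WeierstrassCurve ℚ) [W.IsElliptic] [W.IsGloballyMinimal] {N : ℕ} [NeZero N]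
        (D : ModularParametrizationData W N),
        (∀ z ∈ D.L.lattice, ∃ w ∈ periodLattice D.f, z = D.c * w) →
        ∀ p : ℕ, [Fact p.Prime] → 5 ≤ p → p ^ 2 ∣ N →
        0 ≤ padicValRat p W.j → ¬ tameIndex W p ∣ p - 1 → 7 < p → ¬ (p : ℤ) ∣ D.maninConstant)
    (hR1 : ∀ (W : WeierstrassCurve ℚ) [W.IsElliptic] [W.IsGloballyMinimal] {N : ℕ} [NeZero N]
        (D : ModularParametrizationData W N),
        (∀ z ∈ D.L.lattice, ∃ w ∈ periodLattice D.f, z = D.c * w) →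
        ∀ p : ℕ, [Fact p.Prime] → 5 ≤ p → p ^ 2 ∣ N →
        0 ≤ padicValRat p W.j → ¬ tameIndex W p ∣ p - 1 → p ≤ 7 → ¬ (p : ℤ) ∣ D.maninConstant) :
    Summit.BirchSwinnertonDyer.BirchSwinnertonDyer.Theses.ManinLocalTwoThree.ManinPrimeToAdditiveFiveLe := by
  intro hM hAU hC hnf W _ _ N _ D hopt p hp h5 hpN
  haveI : Fact p.Prime := ⟨hp⟩
  by_cases hq : padicValRat p W.j < 0 ∨ tameIndex W p = 2
  · exact hQ hM hAU hC hnf W D hopt p h5 hpN hq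
  · have hj : 0 ≤ padicValRat p W.j := not_lt.mp (fun h ↦ hq (Or.inl h))
    by_cases hcorner : tameIndex W p = p - 1
    · exact hR2 W D hopt p h5 hpN hj hcorner
    · by_cases hps : tameIndex W p ∣ p - 1
      · by_cases hexc : ¬ W.HasIrreducibleModPGaloisRep p ∨ IsLocallySplitModP W p
        · exact hR3 W D hopt p h5 hpN hj hps hcorner hexc
        · have hirr : W.HasIrreducibleModPGaloisRep p := by
            by_contra h
            exact hexc (Or.inl h)
          have hns : ¬ IsLocallySplitModP W p := fun h ↦ hexc (Or.inr h)
          exact hG hnf W D hopt p h5 hpN hj hps hcorner hirr hns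
      · by_cases h7 : 7 < p
        · exact hF hnf W D hopt p h5 hpN hj hps h7
        · exact hR1 W D hopt p h5 hpN hj hps (by omega)

/-- The line concludes the crux BY NAME from its six registered stubs. -/
theorem ManinPrimeToAdditiveFiveLe_of :
    Summit.BirchSwinnertonDyer.BirchSwinnertonDyer.Theses.ManinLocalTwoThree.ManinPrimeToAdditiveFiveLe :=
  ManinPrimeToAdditiveFiveLe_of_stubs stub_quadraticTwistCell stub_kummerCornerResidual
    stub_nonsplitPrincipalSeriesGauge stub_exceptionalPrincipalSeriesResidual
    stub_edixhovenSupercuspidalCell stub_supercuspidalSmallResidual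

end Summit.BirchSwinnertonDyer.BirchSwinnertonDyer.Cruxes.ManinPrimeToAdditiveFiveLe.OrdinaryGauge

end
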